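import Summits.ValiantsHypothesis.ValiantsHypothesis.Theorems.LacunarySymmetroidMatrixDescartesCensusTwentyRootStructure

/-!
# `MatrixDescartes` census — ROOT STRUCTURE of a hypothetical `(3,4)` nineteen, for ALL supports

HONEST FRAMING.  Object-search cell `pub-symmetroid`, door-A seat `val-sym-door-p3` (item stmt-ValiantsHypothesis-19980 `DoorA34`,
OPEN, never asserted).  A counterexample to `DoorA34` is ONE real symmetric `3 × 3` four-term pencil `F = ∑ X^(d l) • S l` with `19`
distinct positive det-roots (`Census.not_doorA34_iff`).  The `(3,4)` twin of `…CensusTwentyRootStructure` (door-p1, `(2,6)`):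

* `countP_posRoots_det_three_four_le` — ANY four-term `3 × 3` pencil has at most `19` positive det-roots COUNTED WITH MULTIPLICITY;
* `rootMultiplicity_eq_one_of_nineteen` — so all `19` positive det-roots of a nineteen are SIMPLE;
* `pencil_eval_ne_zero_of_nineteen` — and the matrix `F(r)` at such a root is not zero (else `(X − r)³ ∣ det F`).

All supports, symmetry not needed; nothing here bounds `ζ_sym(3,4)`, decides `DoorA34`, or bears on `MatrixDescartes`
(stmt-ValiantsHypothesis-18050) / `VP ≠ VNP`.

[folklore] Descartes' rule with multiplicity; elementary.
-/

-- `Summit.ValiantsHypothesis.ValiantsHypothesis.…` repeats a component by the D-0017 layout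
-- (single-conjunct summit), which the `dupNamespace` linter flags; the name is mandated.
set_option linter.dupNamespace false

namespace Summit.ValiantsHypothesis.ValiantsHypothesis.Theorems.LacunarySymmetroidMatrixDescartes.Census

open Polynomial Finset
open scoped BigOperators Polynomial Matrix

/-- For ANY four-term `3 × 3` pencil (any support, symmetric or not): positive det-roots counted WITH multiplicity number at most
`19 = C(6,3) − 1`. [folklore] -/
theorem countP_posRoots_det_three_four_le (d : Fin 4 → ℕ) (S : Fin 4 → Matrix (Fin 3) (Fin 3) ℝ) :
    (Matrix.det (∑ l, ((X : ℝ[X]) ^ d l) • (S l).map C)).roots.countP (fun x => 0 < x) ≤ 19 := by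
  set p := Matrix.det (∑ l, ((X : ℝ[X]) ^ d l) • (S l).map C) with hp
  by_cases h0 : p = 0
  · rw [h0, Polynomial.roots_zero]; simp
  have h1 : p.roots.countP (fun x => 0 < x) ≤ p.signVariations := p.roots_countP_pos_le_signVariations
  have h2 := Literature.Computability.AlgebraicComplexity.signVariations_lt_card_support h0
  have h3 : p.support.card ≤ Nat.choose (3 + 4 - 1) 3 := StubDescartesCeiling.card_support_det_pencil_le d S
  have h4 : Nat.choose (3 + 4 - 1) 3 = 20 := by decide
  rw [h4] at h3
  omega

/-- **All roots of a `(3,4)` nineteen are simple.**  If a four-term `3 × 3` pencil (any support; symmetry not needed) has at least `19`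
distinct positive det-roots, then every positive det-root has multiplicity exactly `1`. [folklore] -/
theorem rootMultiplicity_eq_one_of_nineteen (d : Fin 4 → ℕ) (S : Fin 4 → Matrix (Fin 3) (Fin 3) ℝ)
    (h19 : 19 ≤ ((Matrix.det (∑ l, ((X : ℝ[X]) ^ d l) • (S l).map C)).roots.toFinset.filter (fun t => 0 < t)).card)
    {r : ℝ} (hr0 : 0 < r) (hr : (Matrix.det (∑ l, ((X : ℝ[X]) ^ d l) • (S l).map C)).IsRoot r) :
    (Matrix.det (∑ l, ((X : ℝ[X]) ^ d l) • (S l).map C)).rootMultiplicity r = 1 := by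
  classical
  set p := Matrix.det (∑ l, ((X : ℝ[X]) ^ d l) • (S l).map C) with hp
  have hp0 : p ≠ 0 := by
    intro h0; rw [h0, Polynomial.roots_zero] at h19; simp at h19
  set Z := p.roots.toFinset.filter (fun t => 0 < t) with hZ
  have hmem : r ∈ Z := by
    rw [hZ, Finset.mem_filter, Multiset.mem_toFinset]; exact ⟨(mem_roots hp0).mpr hr, hr0⟩
  have hle : ∀ x ∈ Z, 1 ≤ p.rootMultiplicity x := by
    intro x hx
    rw [hZ, Finset.mem_filter, Multiset.mem_toFinset] at hx
    exact (rootMultiplicity_pos hp0).mpr ((mem_roots hp0).mp hx.1)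
  have hsum : ∑ x ∈ Z, p.rootMultiplicity x ≤ ∑ x ∈ Z, 1 := by
    rw [← countP_posRoots_eq_sum_rootMultiplicity, ← Finset.card_eq_sum_ones]
    exact (countP_posRoots_det_three_four_le d S).trans h19
  have hsum' : ∑ x ∈ Z, (1 : ℕ) ≤ ∑ x ∈ Z, p.rootMultiplicity x := Finset.sum_le_sum hle
  have heq : ∑ x ∈ Z, (1 : ℕ) = ∑ x ∈ Z, p.rootMultiplicity x := le_antisymm hsum' hsum
  exact ((Finset.sum_eq_sum_iff_of_le hle).mp heq r hmem).symm

/-- If every entry of a `3 × 3` polynomial matrix vanishes at `r`, then `(X − C r)³` divides its determinant. [folklore] -/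
theorem X_sub_C_cube_dvd_det_of_eval_apply_eq_zero (M : Matrix (Fin 3) (Fin 3) ℝ[X]) (r : ℝ)
    (h : ∀ i j, (M i j).IsRoot r) : (X - C r) ^ 3 ∣ M.det := by
  have hd : ∀ i j, X - C r ∣ M i j := fun i j => dvd_iff_isRoot.mpr (h i j)
  have hq : (X - C r) ^ 3 = (X - C r) * (X - C r) * (X - C r) := by ring
  rw [Matrix.det_fin_three, hq]
  have t1 : (X - C r) * (X - C r) * (X - C r) ∣ M 0 0 * M 1 1 * M 2 2 :=
    mul_dvd_mul (mul_dvd_mul (hd 0 0) (hd 1 1)) (hd 2 2)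
  have t2 : (X - C r) * (X - C r) * (X - C r) ∣ M 0 0 * M 1 2 * M 2 1 :=
    mul_dvd_mul (mul_dvd_mul (hd 0 0) (hd 1 2)) (hd 2 1)
  have t3 : (X - C r) * (X - C r) * (X - C r) ∣ M 0 1 * M 1 0 * M 2 2 :=
    mul_dvd_mul (mul_dvd_mul (hd 0 1) (hd 1 0)) (hd 2 2)
  have t4 : (X - C r) * (X - C r) * (X - C r) ∣ M 0 1 * M 1 2 * M 2 0 :=
    mul_dvd_mul (mul_dvd_mul (hd 0 1) (hd 1 2)) (hd 2 0)
  have t5 : (X - C r) * (X - C r) * (X - C r) ∣ M 0 2 * M 1 0 * M 2 1 :=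
    mul_dvd_mul (mul_dvd_mul (hd 0 2) (hd 1 0)) (hd 2 1)
  have t6 : (X - C r) * (X - C r) * (X - C r) ∣ M 0 2 * M 1 1 * M 2 0 :=
    mul_dvd_mul (mul_dvd_mul (hd 0 2) (hd 1 1)) (hd 2 0)
  exact dvd_sub (dvd_add (dvd_add (dvd_sub (dvd_sub t1 t2) t3) t4) t5) t6

/-- **At a root of a `(3,4)` nineteen the matrix is not zero** (any support; symmetry not needed): if `F(r) = 0` at a positive det-root
`r`, that root would be at least triple. [folklore] -/
theorem pencil_eval_ne_zero_of_nineteen (d : Fin 4 → ℕ) (S : Fin 4 → Matrix (Fin 3) (Fin 3) ℝ)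
    (h19 : 19 ≤ ((Matrix.det (∑ l, ((X : ℝ[X]) ^ d l) • (S l).map C)).roots.toFinset.filter (fun t => 0 < t)).card)
    {r : ℝ} (hr0 : 0 < r) (hr : (Matrix.det (∑ l, ((X : ℝ[X]) ^ d l) • (S l).map C)).IsRoot r) :
    (∑ l, r ^ d l • S l) ≠ 0 := by
  classical
  intro hzero
  set P := (∑ l, ((X : ℝ[X]) ^ d l) • (S l).map C) with hP
  have hp0 : P.det ≠ 0 := by
    intro h0; rw [h0, Polynomial.roots_zero] at h19; simp at h19
  have hent : ∀ i j, (P i j).IsRoot r := by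
    intro i j
    rw [IsRoot.def, hP, eval_pencil_apply, hzero]; rfl
  have hdvd := X_sub_C_cube_dvd_det_of_eval_apply_eq_zero P r hent
  have h3 : 3 ≤ P.det.rootMultiplicity r := (le_rootMultiplicity_iff hp0).mpr hdvd
  have h1 := rootMultiplicity_eq_one_of_nineteen d S h19 hr0 hr
  rw [← hP] at h1
  omega

end Summit.ValiantsHypothesis.ValiantsHypothesis.Theorems.LacunarySymmetroidMatrixDescartes.Census
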